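import Summits.AtomisticToContinuum.Crystallization.Theorems.FrustratedLawDichotomyAtlasReachErgodic
import Summits.AtomisticToContinuum.Crystallization.Theorems.FrustratedLawDichotomySignedLedgerErgodic

/-!
# FrustratedLawDichotomy · crux `AperiodicFrustratedLawGap` (stmt-AtomisticToContinuum-27623) — WHAT ERGODICITY BUYS: CLEAN DISPATCH INTO INVARIANT REGIMES
# (decomp-a2c hand-2 g51, STRUCTURAL share of the registered residual `stub_aperiodicErgodicGap`; sequel of #135 `…AtlasReachErgodic` and hand-2 g45's #49 `…SignedLedgerErgodic`)

#135 reduced every mixture-detected regime of (404)'s `NoAdmissibleMinimiserWith` to ERGODIC laws; #49 §2 (`exists_ae_mem_of_ergodic_cover`) showed that an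
ergodic law covered by countably many measurable RE-ROOTING-INVARIANT configuration classes is almost surely carried by ONE of them.  Together:

* §1 ★★ `noAdmissibleMinimiserWith_of_invariantCover` — for a regime `X` detected by kernel mixtures and a countable cover of the rooted `7/10`-hard-core
  configurations by measurable re-rooting-invariant classes `A i`, `NoAdmissibleMinimiserWith X` follows from the PER-CLASS leaves
  `NoAdmissibleMinimiserWith (X ∧ «almost surely in A i»)`, one for each `i` — no mass bookkeeping between the classes, no mixing of types inside one law
  (a general admissible law may mix configuration types; an ergodic one cannot).  `…_of_invariantSplit`: the binary case `B` / `Bᶜ`.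
* §2 specialisations BY NAME: the crux itself (`aperiodicFrustratedLawGap_of_invariantCover`, `…_of_invariantSplit`: «no admissible minimising law a.s.
  carried by `B`» ∧ «none a.s. carried by `Bᶜ`» ⟹ `AperiodicFrustratedLawGap`, for ANY measurable re-rooting-invariant `B`), and the residual of the mass
  split (`offAtlasMassGap_of_invariantCover`: A(η) class by class).

USE (the shape of the cell's current case splits): lens-5 g122's one-orbit / diverse cut and hand-1 g60's NEAR-everywhere / FAR-somewhere geography (r1956)
are splits by configuration-level properties that do not change when the root is moved to another atom; for such a property `B` (once typed as a
measurable invariant set) the two halves become SEPARATE law-level leaves with the crux's full binder list each, by `aperiodicFrustratedLawGap_of_invariantSplit`.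
HONEST LABELS: junction / bookkeeping only; measurability and invariance of a concrete `B` are the user's obligations; nothing is priced.  DEF-FREE (theorems
only); imports TREE #135 `…AtlasReachErgodic` and #49 `…SignedLedgerErgodic` only; no instance / notation / option; 0 sorry.  Tags: [new: junction].
-/

noncomputable section

namespace Summit.AtomisticToContinuum.Crystallization.Theorems.FrustratedLawDichotomyAtlasReachErgodicRegimes

open MeasureTheory Set Filter
open scoped ENNReal BigOperators
open Literature.Probability.Process (IsRootedHardCore IsPointStationaryLaw)
open Literature.Probability.Process.LocalConfig (RootedHardCoreConfig)
open Summit.AtomisticToContinuum.Crystallization.Theorems.ChargedEnergyGapNegative (E3)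
open Summit.AtomisticToContinuum.Crystallization.Theorems.FrustratedLawDichotomyAtlasReach
  (NoAdmissibleMinimiserWith OffAtlasMassGap noAdmissibleMinimiserWith_mono aperiodicFrustratedLawGap_of_noAdmissibleMinimiser)
open Summit.AtomisticToContinuum.Crystallization.Theorems.FrustratedLawDichotomyAtlasReachErgodic
  (noAdmissibleMinimiserWith_of_ergodic frequently_le_measureReal_of_bind)
open Summit.AtomisticToContinuum.Crystallization.Theorems.FrustratedLawDichotomySignedLedgerErgodic (exists_ae_mem_of_ergodic_cover)

/-! ## §1. Dispatch of a detected regime into countably many invariant classes -/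

/-- ★★ **ERGODIC DISPATCH INTO INVARIANT CLASSES.**  Let `X` be a regime detected by kernel mixtures (`hdet`, as in #135 `noAdmissibleMinimiserWith_of_ergodic`;
discharged there for every half-line regime and trivially for `X = True`), and let `A i` (`i` in a countable index type) be measurable classes of
configurations, each RE-ROOTING-INVARIANT (membership does not change when the root is moved to another atom), covering every rooted `7/10`-hard-core
configuration.  If for every `i` no admissible minimising law in the regime `X` is almost surely carried by `A i`, then no admissible minimising law lies
in `X` at all: reduce to an ERGODIC law in `X` (#135), which is almost surely carried by one class (#49 `exists_ae_mem_of_ergodic_cover`). [new: junction] -/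
theorem noAdmissibleMinimiserWith_of_invariantCover {X : Measure (Measure E3) → Prop}
    (hdet : ∀ P : Measure (Measure E3), IsProbabilityMeasure P → (∀ᵐ μ ∂P, IsRootedHardCore (7 / 10) μ) →
      ∀ Q : Measure (RootedHardCoreConfig E3 (7 / 10)), IsProbabilityMeasure Q →
      ∀ F : RootedHardCoreConfig E3 (7 / 10) → Measure (Measure E3), Measurable F → Q.bind F = P →
      (∀ᵐ ω ∂Q, IsProbabilityMeasure (F ω)) → X P → ∃ᵐ ω ∂Q, X (F ω))
    {ι : Type*} [Countable ι] (A : ι → Set (Measure E3)) (hA : ∀ i, MeasurableSet (A i))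
    (hinv : ∀ i, ∀ μ : Measure E3, ∀ p : E3, μ {p} ≠ 0 → (μ ∈ A i ↔ Measure.map (fun z : E3 => z - p) μ ∈ A i))
    (hcover : ∀ μ : Measure E3, IsRootedHardCore (7 / 10) μ → ∃ i, μ ∈ A i)
    (h : ∀ i, NoAdmissibleMinimiserWith fun P => X P ∧ ∀ᵐ μ ∂P, μ ∈ A i) :
    NoAdmissibleMinimiserWith X := by
  refine noAdmissibleMinimiserWith_of_ergodic hdet ?_
  intro P
  dsimp only
  intro hP ha hb hd he h0 hmin hX
  obtain ⟨hXP, herg⟩ := hX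
  haveI := hP
  obtain ⟨i, hi⟩ := exists_ae_mem_of_ergodic_cover A hA hinv herg (ha.mono fun μ hμ => hcover μ hμ)
  have h' := h i P
  dsimp only at h'
  exact h' hP ha hb hd he h0 hmin ⟨hXP, hi⟩

/-- ★ **BINARY INVARIANT SPLIT of a detected regime**: for ONE measurable re-rooting-invariant class `B`, the two leaves «`X` ∧ a.s. in `B`» and
«`X` ∧ a.s. in `Bᶜ`» give `NoAdmissibleMinimiserWith X`. [new: junction] -/
theorem noAdmissibleMinimiserWith_of_invariantSplit {X : Measure (Measure E3) → Prop}
    (hdet : ∀ P : Measure (Measure E3), IsProbabilityMeasure P → (∀ᵐ μ ∂P, IsRootedHardCore (7 / 10) μ) →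
      ∀ Q : Measure (RootedHardCoreConfig E3 (7 / 10)), IsProbabilityMeasure Q →
      ∀ F : RootedHardCoreConfig E3 (7 / 10) → Measure (Measure E3), Measurable F → Q.bind F = P →
      (∀ᵐ ω ∂Q, IsProbabilityMeasure (F ω)) → X P → ∃ᵐ ω ∂Q, X (F ω))
    (B : Set (Measure E3)) (hB : MeasurableSet B)
    (hinv : ∀ μ : Measure E3, ∀ p : E3, μ {p} ≠ 0 → (μ ∈ B ↔ Measure.map (fun z : E3 => z - p) μ ∈ B))
    (h₁ : NoAdmissibleMinimiserWith fun P => X P ∧ ∀ᵐ μ ∂P, μ ∈ B)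
    (h₂ : NoAdmissibleMinimiserWith fun P => X P ∧ ∀ᵐ μ ∂P, μ ∈ Bᶜ) :
    NoAdmissibleMinimiserWith X := by
  refine noAdmissibleMinimiserWith_of_invariantCover hdet (fun b : Bool => if b then B else Bᶜ)
    (fun b => by cases b <;> simp [hB, hB.compl]) (fun b μ p hp => ?_) (fun μ _ => ?_) (fun b => ?_)
  · cases b
    · simp only [Bool.false_eq_true, ↓reduceIte, Set.mem_compl_iff]
      exact not_congr (hinv μ p hp)
    · simp only [↓reduceIte]
      exact hinv μ p hp
  · by_cases hμ : μ ∈ B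
    · exact ⟨true, by simp only [↓reduceIte]; exact hμ⟩
    · exact ⟨false, by simp only [Bool.false_eq_true, ↓reduceIte]; exact hμ⟩
  · cases b
    · simp only [Bool.false_eq_true, ↓reduceIte]
      exact h₂
    · simp only [↓reduceIte]
      exact h₁

/-! ## §2. Specialisations by name: the crux, and the residual of the mass split -/

/-- detection is trivial for the full regime `X = True`. -/
theorem detect_true : ∀ P : Measure (Measure E3), IsProbabilityMeasure P → (∀ᵐ μ ∂P, IsRootedHardCore (7 / 10) μ) →
    ∀ Q : Measure (RootedHardCoreConfig E3 (7 / 10)), IsProbabilityMeasure Q →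
    ∀ F : RootedHardCoreConfig E3 (7 / 10) → Measure (Measure E3), Measurable F → Q.bind F = P →
    (∀ᵐ ω ∂Q, IsProbabilityMeasure (F ω)) → (fun _ : Measure (Measure E3) => True) P →
    ∃ᵐ ω ∂Q, (fun _ : Measure (Measure E3) => True) (F ω) := by
  intro _ _ _ Q hQ _ _ _ _ _
  haveI := hQ
  exact Filter.Eventually.frequently (Filter.Eventually.of_forall fun _ => trivial)

/-- ★★ **THE CRUX, CLASS BY CLASS.**  A countable cover of the rooted `7/10`-hard-core configurations by measurable re-rooting-invariant classes `A i`,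
and for each class the leaf «no admissible minimising law (clauses (a)(b)(d)(e), aperiodic, `E[rootEnergy] ≤ e⋆`) is almost surely carried by `A i`»,
prove `AperiodicFrustratedLawGap` (route decl, BY NAME). [new: junction] -/
theorem aperiodicFrustratedLawGap_of_invariantCover {ι : Type*} [Countable ι] (A : ι → Set (Measure E3)) (hA : ∀ i, MeasurableSet (A i))
    (hinv : ∀ i, ∀ μ : Measure E3, ∀ p : E3, μ {p} ≠ 0 → (μ ∈ A i ↔ Measure.map (fun z : E3 => z - p) μ ∈ A i))
    (hcover : ∀ μ : Measure E3, IsRootedHardCore (7 / 10) μ → ∃ i, μ ∈ A i)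
    (h : ∀ i, NoAdmissibleMinimiserWith fun P => ∀ᵐ μ ∂P, μ ∈ A i) :
    Summit.AtomisticToContinuum.Crystallization.Theses.FrustratedLawDichotomy.AperiodicFrustratedLawGap :=
  aperiodicFrustratedLawGap_of_noAdmissibleMinimiser
    (noAdmissibleMinimiserWith_of_invariantCover detect_true A hA hinv hcover
      fun i => noAdmissibleMinimiserWith_mono (fun _ hP => hP.2) (h i))

/-- ★★ **THE CRUX FROM A BINARY INVARIANT SPLIT.**  For ANY measurable re-rooting-invariant class `B` of configurations: «no admissible minimising law is
almost surely carried by `B`» and «none is almost surely carried by `Bᶜ`» prove `AperiodicFrustratedLawGap` — the law-level form of a split by a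
configuration property that does not depend on the root (one-orbit / diverse; NEAR-everywhere / FAR-somewhere; periodic / not). [new: junction] -/
theorem aperiodicFrustratedLawGap_of_invariantSplit (B : Set (Measure E3)) (hB : MeasurableSet B)
    (hinv : ∀ μ : Measure E3, ∀ p : E3, μ {p} ≠ 0 → (μ ∈ B ↔ Measure.map (fun z : E3 => z - p) μ ∈ B))
    (h₁ : NoAdmissibleMinimiserWith fun P => ∀ᵐ μ ∂P, μ ∈ B) (h₂ : NoAdmissibleMinimiserWith fun P => ∀ᵐ μ ∂P, μ ∈ Bᶜ) :
    Summit.AtomisticToContinuum.Crystallization.Theses.FrustratedLawDichotomy.AperiodicFrustratedLawGap :=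
  aperiodicFrustratedLawGap_of_noAdmissibleMinimiser
    (noAdmissibleMinimiserWith_of_invariantSplit detect_true B hB hinv
      (noAdmissibleMinimiserWith_mono (fun _ hP => hP.2) h₁) (noAdmissibleMinimiserWith_mono (fun _ hP => hP.2) h₂))

/-- ★ **A(η), CLASS BY CLASS**: the residual of the mass split `OffAtlasMassGap n K η` from the per-class leaves «mass `≥ η` off the rows ∧ almost surely
carried by `A i`» (detection of the lower half-line mass regime = #135 `frequently_le_measureReal_of_bind`). [new: junction] -/
theorem offAtlasMassGap_of_invariantCover (n : ℕ) (K : ℕ → Set (Measure E3)) (hK : ∀ i, MeasurableSet (K i)) (η : ℝ)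
    {ι : Type*} [Countable ι] (A : ι → Set (Measure E3)) (hA : ∀ i, MeasurableSet (A i))
    (hinv : ∀ i, ∀ μ : Measure E3, ∀ p : E3, μ {p} ≠ 0 → (μ ∈ A i ↔ Measure.map (fun z : E3 => z - p) μ ∈ A i))
    (hcover : ∀ μ : Measure E3, IsRootedHardCore (7 / 10) μ → ∃ i, μ ∈ A i)
    (h : ∀ i, NoAdmissibleMinimiserWith fun P => η ≤ P.real (⋃ j ∈ Finset.range n, K j)ᶜ ∧ ∀ᵐ μ ∂P, μ ∈ A i) :
    OffAtlasMassGap n K η := by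
  refine noAdmissibleMinimiserWith_of_invariantCover (fun P hP _ Q hQ F hF hbind hfinF hX => ?_) A hA hinv hcover h
  haveI := hP
  haveI := hQ
  have hU : MeasurableSet (⋃ j ∈ Finset.range n, K j)ᶜ := (Finset.measurableSet_biUnion _ fun j _ => hK j).compl
  have hfin : Q.bind F (⋃ j ∈ Finset.range n, K j)ᶜ ≠ ∞ := by rw [hbind]; exact measure_ne_top P _
  have hX' : η ≤ (Q.bind F).real (⋃ j ∈ Finset.range n, K j)ᶜ := by rw [hbind]; exact hX
  exact frequently_le_measureReal_of_bind hF (hfinF.mono fun ω hω => by haveI := hω; infer_instance) hU hfin hX'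

end Summit.AtomisticToContinuum.Crystallization.Theorems.FrustratedLawDichotomyAtlasReachErgodicRegimes

end
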